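import Summits.NavierStokesRegularity.NavierStokesRegularity.Theses.AxisymmetricExtremality
import Summits.NavierStokesRegularity.NavierStokesRegularity.Theorems.AxisymmetricExtremalityMinimalDatumPFoldBranchOfAxisymMinimalDatum
import Summits.NavierStokesRegularity.NavierStokesRegularity.Theorems.AxisymmetricLiouvilleBoundedSwirl
import Literature.Analysis.FluidPDE.RusinSverakCompactness
import Literature.Analysis.FluidPDE.AxisymmetricEuler

/-!
# Strategist census sketch s12-g8 — crux `AxisymmetricExtremality.AxisymmetricKatoGlobal`
# (stmt-NavierStokesRegularity-15453), INDEPENDENT census family `-s`, generation 8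

Typed companions of `STRATEGY-CENSUS-s12-g8.md` (nothing here is a registered line; no `sorry`):

* `NoAxisymMinimalBlowupDatum` (W₁) — the THRESHOLD INSTANCE of the crux, i.e. exactly what the
  route's deciding theorem `closes` consumes; `noAxisymMinimal_of_crux : C → W₁` and
  `closes_of_threshold : MinimalDatumPFold → PFoldToAxisymmetric → W₁ → NavierStokesRegularity`
  (the same five lines of logic as `closes`), so W₁ is a strictly-weaker intermediate that COULD
  replace the crux in the glue (a route edit, tenure planner's call) — the census explains why it
  has no line of its own.
* `NoAxisymSubthresholdConcentration` (W₁') — the quantitative form of W₁ forced by the landed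
  dominance converse `Theorems.stub_branchOfAxisymMinimalDatum` (Rusin–Šverák 2011 §4): W₁' → W₁
  (`noAxisymMinimal_of_noConcentration`). W₁' is uniform-in-data regularity of axisymmetric
  SUB-threshold (hence global) Kato solutions — AX in quantitative clothing.
* `LiouvilleRoute` (S⁺) — the Kenig–Merle / KNSS strengthening: the tree's conjecture leaf
  `AxisymmetricLiouvilleBoundedSwirl` is recorded as the rigidity half; the census explains why
  the compactness half does not reach it from `Ḣ^{1/2}` data (no `Γ ∈ L^∞`) and why S⁺ is harder.
-/

set_option linter.dupNamespace false

namespace Summit.NavierStokesRegularity.NavierStokesRegularity.Cruxes.AxisymmetricKatoGlobal.StrategistS12g8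

open Literature.Analysis.FluidPDE Literature.Analysis.FunctionSpaces MeasureTheory Set

local notation "ℝ³" => EuclideanSpace ℝ (Fin 3)
local notation "ℂ³" => EuclideanSpace ℂ (Fin 3)

/-- **W₁ (threshold instance).** No Rusin–Šverák minimal blow-up datum is axisymmetric: for every
`ν > 0`, every `(u₀, g)` with `IsMinimalBlowupDatum ν u₀ g` (L³, represented in `Ḣ^{1/2}`, weakly
divergence-free, `‖g‖ = ρ_max^pure(ν)`, no global Kato solution) is NOT equivariant under all
rotations about the `x₂`-axis. This is the only instance of the crux used by `closes`. -/
def NoAxisymMinimalBlowupDatum : Prop :=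
  ∀ ν : ℝ, 0 < ν → ∀ (u₀ : ℝ³ → ℝ³) (g : HomSobolev ℝ³ ℂ³ (1 / 2 : ℝ)),
    IsMinimalBlowupDatum ν u₀ g → IsAxisymmetric u₀ → False

/-- `C → W₁`: the crux implies its threshold instance (unpack the minimality clause). -/
theorem noAxisymMinimal_of_crux (h : Theses.AxisymmetricExtremality.AxisymmetricKatoGlobal) :
    NoAxisymMinimalBlowupDatum := by
  intro ν hν u₀ g hmin hax
  obtain ⟨hL3, hrep, hdiv, -, hnot⟩ := hmin
  exact hnot (h ν hν u₀ g hL3 hrep hdiv (fun θ x => hax θ x))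

/-- The route's deciding theorem re-glued on W₁ instead of the crux (same logic as `closes`):
W₁ is a legitimate strictly-weaker replacement of `AxisymmetricKatoGlobal` in the glue. -/
theorem closes_of_threshold (h₂ : Theses.AxisymmetricExtremality.MinimalDatumPFold)
    (h₄ : Theses.AxisymmetricExtremality.PFoldToAxisymmetric) (hW : NoAxisymMinimalBlowupDatum) :
    NavierStokesRegularity := by
  show Literature.NS.NavierStokesExistenceSmoothR3
  intro ν hν u₀ hsm hdiv hdec
  by_contra hno
  obtain ⟨u₁, g, hmin, hax⟩ := h₄ ν hν (h₂ ν hν ⟨u₀, hsm, hdiv, hdec, hno⟩)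
  exact hW ν hν u₁ g hmin (fun θ x => hax θ x)

/-- **W₁' (no sub-threshold axisymmetric concentration).** For every `ν > 0` there is NO sequence
of axisymmetric, weakly divergence-free `L³` data `U k` with `Ḣ^{1/2}` classes `G k` of norm
`< ρ_max^pure(ν)` whose Kato solutions `u k` on `[0, 1)` concentrate at points `(1, x k)` (the
`L^∞` norms on every backward parabolic cylinder `Q_r(1, x k)` tend to `∞`). Verbatim the negated
conclusion of `Theorems.stub_branchOfAxisymMinimalDatum`. -/
def NoAxisymSubthresholdConcentration : Prop :=
  ∀ ν : ℝ, 0 < ν → ¬ ∃ (U : ℕ → ℝ³ → ℝ³) (G : ℕ → HomSobolev ℝ³ ℂ³ (1 / 2 : ℝ))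
      (u : ℕ → ℝ → ℝ³ → ℝ³) (x : ℕ → ℝ³),
      (∀ k, MemLp (U k) 3 (volume : Measure ℝ³) ∧
        (G k).Represents (Literature.Analysis.FunctionSpaces.EuclideanSpace.complexify ∘ U k) ∧
        IsWeaklyDivFree (U k) ∧ ‖G k‖ₑ < rusinSverakRhoMaxPure ν) ∧
      (∀ k, IsMildNSSolutionOn (Ico 0 1) ν 0 (U k) (u k) ∧ ContinuousInLpOn (Ico 0 1) 3 (u k) ∧
        u k 0 = U k ∧ AEStronglyMeasurable (Function.uncurry (u k))
          (volume.restrict (Ioo (0 : ℝ) 1 ×ˢ (univ : Set ℝ³)))) ∧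
      (∀ r : ℝ, 0 < r → Filter.Tendsto (fun k => eLpNorm (Function.uncurry (u k)) ⊤
          (volume.restrict (parabolicCylinder r ((1 : ℝ), x k)))) Filter.atTop (nhds ⊤)) ∧
      (∀ k (θ : ℝ) (y : ℝ³), U k (WithLp.toLp 2 ![Real.cos θ * y 0 - Real.sin θ * y 1,
          Real.sin θ * y 0 + Real.cos θ * y 1, y 2]) =
        WithLp.toLp 2 ![Real.cos θ * U k y 0 - Real.sin θ * U k y 1,
          Real.sin θ * U k y 0 + Real.cos θ * U k y 1, U k y 2])

/-- `W₁' → W₁` by the landed dominance converse (Rusin–Šverák 2011, §4, Thm 4.1–4.2, proof of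
Cor. 4.3): an axisymmetric minimal blow-up datum spawns a concentrating sub-threshold
axisymmetric sequence. So the threshold instance is EQUIVALENTLY a uniform-regularity statement
for axisymmetric global solutions below the threshold. -/
theorem noAxisymMinimal_of_noConcentration (h : NoAxisymSubthresholdConcentration) :
    NoAxisymMinimalBlowupDatum := by
  intro ν hν u₀ g hmin hax
  exact h ν hν (Theorems.stub_branchOfAxisymMinimalDatum ν hν ⟨u₀, g, hmin, fun θ y => hax θ y⟩)

/-- **S⁺ (strengthen-to-rigidity), recorded by name.** The Kenig–Merle / KNSS shape would be
`Compactness ∧ Rigidity → C` with Rigidity = the tree's OPEN conjecture leaf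
`AxisymmetricLiouvilleBoundedSwirl` (KNSS 2009 §5, Liouville for bounded ancient axisymmetric mild
solutions with bounded swirl). We only record the leaf's type here; the census (§ Strengthen)
explains why the compactness half is not available for `Ḣ^{1/2}` data (no `Γ ∈ L^∞`, and the
zoom limit at a Type II axis point need not inherit a nontrivial bounded swirl) and why the leaf
is at least as hard as the crux (it contains the bounded steady Liouville problem). -/
def RigidityHalf : Prop := AxisymmetricLiouvilleBoundedSwirl

example : RigidityHalf ↔ AxisymmetricLiouvilleBoundedSwirl := Iff.rfl

end Summit.NavierStokesRegularity.NavierStokesRegularity.Cruxes.AxisymmetricKatoGlobal.StrategistS12g8
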